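import Mathlib
import Summits.MatrixMultiplication.MatrixMultiplication.Theses.FourierTwoFamiliesModP

/-!
# Sketch — first lemmas for crux ideas on `FourierTwoFamiliesModP.PrimeLogDecay`
(planner-cruxidea-stmt-MatrixMultiplication-14310-2-0, round 1, ideator 2).
Statements only (`def … : Prop`); nothing here is proved. They are stated over Mathlib + the route decls.
-/

open scoped BigOperators Pointwise

namespace Summit.MatrixMultiplication.MatrixMultiplication.Cruxes.PrimeLogDecay.IdeatorTwo

/-- The crux, by name (sanity: the route decl resolves). -/
example : Prop := Summit.MatrixMultiplication.MatrixMultiplication.Theses.FourierTwoFamiliesModP.PrimeLogDecay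

/-- (W): each `A i ⊕ B i` is direct. Verbatim the route's clause. -/
def CondW {p n : ℕ} (A B : Fin n → Finset (ZMod p)) : Prop :=
  ∀ i : Fin n, ∀ a ∈ A i, ∀ a' ∈ A i, ∀ b ∈ B i, ∀ b' ∈ B i, (a - a') + (b - b') = 0 → a = a' ∧ b = b'

/-- (X): the simultaneous double product property, cross clause. Verbatim the route's clause. -/
def CondX {p n : ℕ} (A B : Fin n → Finset (ZMod p)) : Prop :=
  ∀ i j k : Fin n, ∀ a ∈ A i, ∀ a' ∈ A j, ∀ b ∈ B j, ∀ b' ∈ B k, (a - a') + (b - b') = 0 → i = k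

/-- Balanced: all blocks have size `s`. -/
def Balanced {p n : ℕ} (s : ℕ) (A B : Fin n → Finset (ZMod p)) : Prop :=
  ∀ i : Fin n, (A i).card = s ∧ (B i).card = s

/-- The matched-difference set `Δ = ⋃ⱼ (A j − B j)`. -/
def delta {p n : ℕ} (A B : Fin n → Finset (ZMod p)) : Finset (ZMod p) :=
  Finset.univ.biUnion fun j => A j - B j

/-- `X = ⊔ A i`, `Y = ⊔ B i`. -/
def bigX {p n : ℕ} (A : Fin n → Finset (ZMod p)) : Finset (ZMod p) := Finset.univ.biUnion A

/-- `r d = #{(x,y) ∈ X × Y : x − y = d}`. -/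
def pairCount {p n : ℕ} (A B : Fin n → Finset (ZMod p)) (d : ZMod p) : ℕ :=
  (((bigX A) ×ˢ (bigX B)).filter fun xy => xy.1 - xy.2 = d).card

/-! ## Card `fixed-delta-theta-certificate` — first lemmas -/

/-- F0. Conditioning on `Δ` makes (X) PAIRWISE: the free middle index disappears. -/
def PairwiseForm : Prop :=
  ∀ (p n : ℕ) (A B : Fin n → Finset (ZMod p)),
    CondX A B ↔ ∀ i k : Fin n, i ≠ k → Disjoint (A i - B k) (delta A B)

/-- Degree-one certificate family (the scalar Delsarte bound; `F = Dfun/n` recovers HalfDensity):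
for every real test function `F` that is `≤ 1` on `Δ` and `≤ 0` off `Δ`, and every bound `M` on its
non-trivial Fourier coefficients, `ρ·ΣF − (1−ρ)·M ≤ s` with `ρ = ns/p`. -/
def DegreeOneCertificate : Prop :=
  ∀ (p : ℕ) [Fact p.Prime] (n s : ℕ) (A B : Fin n → Finset (ZMod p)) (F : ZMod p → ℝ) (M : ℝ),
    Balanced s A B → CondW A B → CondX A B →
    (∀ d, d ∉ delta A B → F d ≤ 0) → (∀ d ∈ delta A B, F d ≤ 1) →
    (∀ ψ : AddChar (ZMod p) ℂ, ψ ≠ 1 → ‖∑ d : ZMod p, (F d : ℂ) * ψ d‖ ≤ M) →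
    ((n : ℝ) * s / p) * (∑ d : ZMod p, F d) - (1 - (n : ℝ) * s / p) * M ≤ s

/-! ## Card `delta-trace-rigidity` — first lemmas -/

/-- F1. Trace identity: for `x ∈ A i`, the translate `x − Δ` cuts exactly the block `B i` out of `Y`. -/
def TraceIdentity : Prop :=
  ∀ (p n : ℕ) (A B : Fin n → Finset (ZMod p)), CondX A B →
    ∀ i : Fin n, ∀ x ∈ A i, ((bigX B).filter fun y => x - y ∈ delta A B) = B i

/-- Corollary of F1: `|Δ| + n·s ≤ p + s` (the rest of `Y` avoids `x − Δ`). -/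
def DeltaCardBound : Prop :=
  ∀ (p : ℕ), p.Prime → ∀ (n s : ℕ) (A B : Fin n → Finset (ZMod p)),
    Balanced s A B → CondW A B → CondX A B → (delta A B).card + n * s ≤ p + s

/-- F5. Pseudorandom half (second moment of `1_Y ∗ 1_Δ`, which is `≡ s` on `X`): if the
autocorrelation of `Y` is `ε`-flat at every non-zero difference then `ρ ≤ 2/s + 2√ε`. -/
def UniformHalfPowerGain : Prop :=
  ∀ (p : ℕ), p.Prime → ∀ (n s : ℕ) (A B : Fin n → Finset (ZMod p)) (ε : ℝ), 0 ≤ ε →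
    Balanced s A B → CondW A B → CondX A B →
    (∀ d : ZMod p, d ≠ 0 →
      |((((bigX B) ∩ ((bigX B).image fun y => y + d)).card : ℕ) : ℝ) - ((n : ℝ) * s) ^ 2 / p|
        ≤ ε * ((n : ℝ) * s)) →
    (n : ℝ) * s / p ≤ 2 / s + 2 * Real.sqrt ε

/-- F6. Trace rigidity: an internal block difference `d` realised at `x, x+d ∈ A i` makes the
symmetric difference `Δ △ (Δ − d)` avoid the translate `x − Y`. -/
def TraceRigidity : Prop :=
  ∀ (p n : ℕ) (A B : Fin n → Finset (ZMod p)), CondX A B →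
    ∀ i : Fin n, ∀ x ∈ A i, ∀ d : ZMod p, x + d ∈ A i →
      Disjoint (symmDiff (delta A B) ((delta A B).image fun t => t - d)) ((bigX B).image fun y => x - y)

/-- F3. Near-tiling bound (Cauchy–Davenport, uses primality): `n ≥ 2 ⟹ n·s + s² ≤ p + 1`. -/
def NearTilingBound : Prop :=
  ∀ (p : ℕ), p.Prime → ∀ (n s : ℕ) (A B : Fin n → Finset (ZMod p)), 2 ≤ n → 1 ≤ s →
    Balanced s A B → CondW A B → CondX A B → n * s + s ^ 2 ≤ p + 1

/-! ## Card `km-sifting-localized-rounds` — first lemma -/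

/-- F7. Hölder lift of the multiplicative deficit `⟨μ_X ∘ μ_Y, ν⟩ ≤ 1/(ρs)`: beyond twice the wall,
the normalised pair-count `F(d) = p·r(d)/(ns)²` (mean 1) deviates from 1 in every even moment,
with NO dependence on the dilution `p/s²` in this unnormalised form. -/
def HolderLift : Prop :=
  ∀ (p : ℕ) [Fact p.Prime] (n s : ℕ) (A B : Fin n → Finset (ZMod p)),
    Balanced s A B → CondW A B → CondX A B → 2 * p ≤ n * s ^ 2 →
    ∀ k : ℕ, 1 ≤ k →
      (s : ℝ) ^ 2 / 4 ^ k ≤ ∑ d : ZMod p, (1 - (p : ℝ) * (pairCount A B d) / ((n : ℝ) * s) ^ 2) ^ (2 * k)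

end Summit.MatrixMultiplication.MatrixMultiplication.Cruxes.PrimeLogDecay.IdeatorTwo
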